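import Summits.QuantumFields.Balaban3D.Proofs.Run3Collar
import Summits.QuantumFields.Balaban3D.Carriers.Standard
import Literature.MathematicalPhysics.QuantumFieldTheory.Balaban1983to89.B10LargeFieldSum
import HarnessLib

/-!
# R3 (cell `ym3-torus`, YM₃ on T³ — a ladder RUNG, NOT d = 4, NOT the Clay problem), UV3-node side of R-19936-S — **THE COLLAR BRANCH OF THE PINNED FAMILY:
# a plaquette outside `Ω_j(h)` lies in the counted collar of an EARLIER large-field plaquette of `h`; the candidates per scale are counted, and their
# surviving small factors sum, down the scales, to a multiple of the pinned plaquette's own factor**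

Seat `ym-ust-19936-w6` g7 (R526 (S) hand; LOCATE `LOCATE-S-ORGAN-w6g7.md`, 19936 evidence #60, row T5).  THEOREMS ONLY (0 `def`, 0 `sorry`);
`--supports stmt-QuantumFields-19936 --as helper`; count-neutral.

WHY.  The (S-ii) organ row `hSii` of R-19936-S (`ym3-torus-px8` g11's (S-KNIT)) sums the (41)_K histories over the family `{r : a ∈ P_j(r)} ∪ {r : ¬ plaqCover a ⊆ Ω_j(r↾j)}`
(✓p749282 BRICK C): the pinned plaquette `a` of level `j` is either RECORDED as large at level `j`, or it is not inside the region `Ω_j` where the decomposition of unity of the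
passage `j → j+1` is made — i.e. it meets the accumulated collars `Z` of the history's EARLIER large fields ([Balaban1985UV3] (38)–(39) p. 266, the rule pp. 267–268).  The
second branch is a finite union over CANDIDATE earlier plaquettes near `a`; each candidate pins the resummation (FILE 1 ✓`UV3LargeFieldEnvelopedResummation.largeField_enveloped_adm`
(P)) and leaves `exp(−(c₁∕8)p(g_i)²)` at its own scale `i < j`, where `p(g_i) ≥ p(g_j)`.  THIS FILE supplies the two facts the knit needs:
* §1 GEOMETRY (the lane's regions `Carriers.Omega`, verbatim): ★ `exists_near_of_not_plaqCover_subset_Omega` — `¬ plaqCover a ⊆ Ω_j(h)` ⟹ some `p ∈ P_i(h)`, `i < j`, has a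
  covered site within scale-`(j−1)` distance `ϱ_i = 2(Rcol i + B + d) + 1` of a covered site of `a` (`Run3Collar.collar_chain`); `sdist_le_pow_mul` (descending the scales
  costs a factor `L` per level, `Run3Collar.sdist_le_succ`); ★★ `card_filter_near_le` — the number of scale-`i` plaquettes with a covered site that close to `a` is at most
  `d²·(2(R + 1))^d`, `R = L^{j−1−i}(ϱ + L(2d+6) + d(L−1) + d) + 2` (torus ball count `TorusBalls.card_torusBall_le` around a fine site under `a`'s base point);
  ★ `zvol_real_le_sum` — the lane's collar count `Run3LargeField.collar_tower3` («|Z_j(h)| ≤ Σ_{(i,p′)∈P(h), i≤j} (K_c·x(g_i)^{r₀})³») with the big-block size `M₁` and the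
  collar widths `Rcol` as PARAMETERS (the lane states it for a standard `TowerInput`; the AC tower has the same `M₁`, `rcolOf`).
* §2 ARITHMETIC (pure real): ★ `rpow_mul_exp_neg_le` (`x^q·e^{−(κ∕2)x^s} ≤ e^{−(κ∕2)x²}` for `x ≥ 1`, `κ ≥ 2`, `q + 2 ≤ s`, `q ≥ 0`), ★ `exp_neg_half_sq_le` (`x ≥ 1 + t` ⟹
  `e^{−(κ∕2)x²} ≤ e^{−κt}`), ★★ `scaleSum_collar_le` — with per-scale counts `≤ C·e^{σ(j−1−i)}·x_i^q`, the progression `x_i − x_j = (j − i)ℓ`, `x_j ≥ 1`, and the provisos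
  `κℓ ≥ σ + ℓ`, `κ ≥ 2`, `q + 2 ≤ s`: `Σ_{i<j} count_i·exp(−κ x_i^s) ≤ (C∕ℓ)·exp(−(κ∕2)·x_j^s)` — half of the small factor of the nearest scale survives, uniformly in `j`.

HONEST SCOPE.  Lattice-geometric and real-arithmetic bookkeeping over the lane's definitions; nothing of `hSii`, `hlf`, the mass envelope hJ, `stub_pinnedStep`, `HistoryTailL` (19936),
the rung, d = 4, a mass gap or Clay is proved here.

References: T. Bałaban, Commun. Math. Phys. **102** (1985) 255–275 [Balaban1985UV3] ((38)–(39) p. 266, (41) p. 266, pp. 267–268, (67)–(71) p. 273, pp. 273–274, (7) p. 257).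
-/

set_option autoImplicit false

namespace Summit.QuantumFields.YangMills.Theorems.UV3PinnedCollarBranch

open scoped BigOperators
open Literature.MathematicalPhysics.QuantumFieldTheory.Balaban1983to89
open Literature.MathematicalPhysics.QuantumFieldTheory.Balaban1983to89.B3Taylor310LocalRemainder (tdist_comm tdist_triangle)
open Literature.MathematicalPhysics.QuantumFieldTheory.Balaban1983to89.B10LargeField (xlog one_le_xlog)
open Literature.MathematicalPhysics.QuantumFieldTheory.Balaban1983to89.B10LargeFieldSum (geomTail_le expTail_le)
open Literature.MathematicalPhysics.QuantumFieldTheory.Balaban1985CMP102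
open Literature.MathematicalPhysics.QuantumFieldTheory.Balaban1985CMP102.Setting
open Summit.QuantumFields.Balaban3D.Carriers
open Summit.QuantumFields.Balaban3D.Proofs.Run3Collar
open Summit.QuantumFields.Balaban3D.Proofs.TorusBalls (card_torusBall_le)

/-! ## §1 Geometry of the collar branch -/

section Geometry

variable {P : Params} (M₁ : ℕ) (Rcol : ℕ → ℕ)

/-- ★ **A PLAQUETTE NOT INSIDE `Ω_j(h)` IS NEAR AN EARLIER LARGE-FIELD PLAQUETTE OF `h`** ((38)–(39) p. 266 and the rule of pp. 267–268, read on the lane's regions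
`Carriers.Omega`): if `¬ plaqCover a ⊆ Ω_j(h)` for a history `h` of level `j` (collar widths antitone on the window, `L ≥ 2`), then some `p ∈ P_i(h)`, `i < j`, has a covered
site `c` and `a` a covered site `x` with `sdist (j−1) c x ≤ 2(Rcol i + (L·d(M₁−1) + d(L−1)) + d) + 1` — `Run3Collar.collar_chain` at a covered site of `a` outside `Ω_j(h)`.
[cite: Balaban1985UV3, (38)–(39) p.266, pp.267–268] -/
theorem exists_near_of_not_plaqCover_subset_Omega (hM : 0 < M₁) {N : ℕ} (hRcol : ∀ i j, i ≤ j → j ≤ N → Rcol j ≤ Rcol i)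
    (hL : 2 ≤ P.L) {j : ℕ} (hj : j ≤ P.m + P.K) (hjN : j ≤ N) (h : Hist P j) (a : Plaq P j)
    (hna : ¬ plaqCover a ⊆ Omega M₁ Rcol j h j) :
    ∃ (i : ℕ) (hi : i < j) (p : Plaq P i), p ∈ h ⟨i, hi⟩ ∧ ∃ c ∈ plaqCover p, ∃ x ∈ plaqCover a,
      sdist (j - 1) c x ≤ 2 * (Rcol i + (P.L * (P.d * (M₁ - 1)) + P.d * (P.L - 1)) + P.d) + 1 := by
  rw [Set.not_subset] at hna
  obtain ⟨x, hx, hxΩ⟩ := hna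
  obtain ⟨i, hi, p, hp, c, hc, hci⟩ := collar_chain M₁ Rcol hM hRcol hL j hj hjN h x hxΩ
  exact ⟨i, hi, p, hp, c, hc, x, hx, hci⟩

/-- Descending the scales: `sdist i c y ≤ L^m·(sdist (i+m) c y + d)` on the standing range (`Run3Collar.sdist_le_succ` iterated). [folklore] -/
theorem sdist_le_pow_mul (c y : Site P 0) (i : ℕ) :
    ∀ m : ℕ, i + m ≤ P.m + P.K → sdist i c y ≤ P.L ^ m * (sdist (i + m) c y + P.d) := by
  intro m
  induction m with
  | zero => intro _; simp
  | succ m ih =>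
    intro him
    have h1 := ih (by omega)
    have h2 : sdist (i + m) c y ≤ P.L * sdist (i + m + 1) c y + P.d * (P.L - 1) := sdist_le_succ (by omega) c y
    have hL1 : 1 ≤ P.L := P.L_pos
    have h3 : sdist (i + m) c y + P.d ≤ P.L * (sdist (i + (m + 1)) c y + P.d) := by
      rw [← Nat.add_assoc]
      have : P.d * (P.L - 1) + P.d = P.L * P.d := by
        rw [Nat.mul_sub, Nat.mul_one, Nat.mul_comm P.L P.d]
        exact Nat.sub_add_cancel (Nat.le_mul_of_pos_right _ P.L_pos)
      nlinarith
    calc sdist i c y ≤ P.L ^ m * (sdist (i + m) c y + P.d) := h1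
      _ ≤ P.L ^ m * (P.L * (sdist (i + (m + 1)) c y + P.d)) := Nat.mul_le_mul_left _ h3
      _ = P.L ^ (m + 1) * (sdist (i + (m + 1)) c y + P.d) := by rw [pow_succ]; ring

open Classical in
/-- ★★ **THE SCALE-`i` CANDIDATES NEAR A LEVEL-`j` PLAQUETTE ARE COUNTED**: for `i < j ≤ m + K` and any `ϱ`, the scale-`i` plaquettes having a covered site within scale-`(j−1)`
distance `ϱ` of a covered site of the level-`j` plaquette `a` number at most `d²·(2(R + 1))^d`, `R = L^{j−1−i}·(ϱ + L(2d + 6) + d(L − 1) + d) + 2`: all their base points lie in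
the scale-`i` torus ball of radius `R` around a fine site under `a`'s base point (spread of `a`'s covered sites `Run3Collar.sdist_le_of_mem_plaqCover`, one expansion
`sdist_le_succ`, the descent `sdist_le_pow_mul`, the corner offset `tdist_src_le_of_mem_plaqCover`), counted by `TorusBalls.card_torusBall_le`, times the `d²` orientations.
[cite: Balaban1985UV3, (39) p.266, pp.273–274] -/
theorem card_filter_near_le (hL : 2 ≤ P.L) {i j : ℕ} (hij : i < j) (hj : j ≤ P.m + P.K) (a : Plaq P j) (ϱ : ℕ) :
    ((Finset.univ : Finset (Plaq P i)).filter
        (fun p => ∃ c ∈ plaqCover p, ∃ x ∈ plaqCover a, sdist (j - 1) c x ≤ ϱ)).card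
      ≤ P.d * P.d * (2 * (P.L ^ (j - 1 - i) * (ϱ + P.L * (2 * P.d + 6) + P.d * (P.L - 1) + P.d) + 2 + 1)) ^ P.d := by
  classical
  -- a fine site under the base point of `a`
  obtain ⟨x₀, hx₀⟩ := coarsen_surjective j hj a.src
  have hx₀a : x₀ ∈ plaqCover a := Or.inl hx₀
  set R : ℕ := P.L ^ (j - 1 - i) * (ϱ + P.L * (2 * P.d + 6) + P.d * (P.L - 1) + P.d) + 2 with hR
  set ball : Finset (Site P i) := Finset.univ.filter (fun y => Site.tdist (coarsen i x₀) y ≤ R) with hball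
  -- every near plaquette has its base point in the ball
  have hsrc : ∀ p ∈ (Finset.univ : Finset (Plaq P i)).filter
      (fun p => ∃ c ∈ plaqCover p, ∃ x ∈ plaqCover a, sdist (j - 1) c x ≤ ϱ), p.src ∈ ball := by
    intro p hp
    rw [Finset.mem_filter] at hp
    obtain ⟨c, hc, x, hx, hcx⟩ := hp.2
    rw [hball, Finset.mem_filter]
    refine ⟨Finset.mem_univ _, ?_⟩
    have hj1 : j - 1 + 1 = j := by omega
    -- the spread of `a`'s covered sites, one scale down
    have hxx₀j : sdist j x x₀ ≤ 2 * P.d + 6 := by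
      have := sdist_le_of_mem_plaqCover hL hx hx₀a 0 (by omega)
      simpa using this
    have hxx₀ : sdist (j - 1) x x₀ ≤ P.L * (2 * P.d + 6) + P.d * (P.L - 1) := by
      have h1 := sdist_le_succ (j := j - 1) (by omega) x x₀
      rw [hj1] at h1
      exact h1.trans (Nat.add_le_add_right (Nat.mul_le_mul_left _ hxx₀j) _)
    have hcx₀ : sdist (j - 1) c x₀ ≤ ϱ + P.L * (2 * P.d + 6) + P.d * (P.L - 1) := by
      calc sdist (j - 1) c x₀ ≤ sdist (j - 1) c x + sdist (j - 1) x x₀ := sdist_triangle _ c x x₀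
        _ ≤ ϱ + (P.L * (2 * P.d + 6) + P.d * (P.L - 1)) := Nat.add_le_add hcx hxx₀
        _ = ϱ + P.L * (2 * P.d + 6) + P.d * (P.L - 1) := by rw [Nat.add_assoc]
    -- descend to scale `i`
    have hdesc : sdist i c x₀ ≤ P.L ^ (j - 1 - i) * (ϱ + P.L * (2 * P.d + 6) + P.d * (P.L - 1) + P.d) := by
      have h1 := sdist_le_pow_mul c x₀ i (j - 1 - i) (by omega)
      have hidx : i + (j - 1 - i) = j - 1 := by omega
      rw [hidx] at h1
      exact h1.trans (Nat.mul_le_mul_left _ (Nat.add_le_add_right hcx₀ _))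
    -- the base point of `p` is within `2` of the block of `c`
    have hpc : Site.tdist (coarsen i c) p.src ≤ 2 := by
      rw [tdist_comm]; exact tdist_src_le_of_mem_plaqCover hc
    calc Site.tdist (coarsen i x₀) p.src ≤ Site.tdist (coarsen i x₀) (coarsen i c) + Site.tdist (coarsen i c) p.src :=
          tdist_triangle _ _ _
      _ ≤ P.L ^ (j - 1 - i) * (ϱ + P.L * (2 * P.d + 6) + P.d * (P.L - 1) + P.d) + 2 := by
          refine Nat.add_le_add ?_ hpc
          have : Site.tdist (coarsen i x₀) (coarsen i c) = sdist i c x₀ := by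
            show Site.tdist (coarsen i x₀) (coarsen i c) = Site.tdist (coarsen i c) (coarsen i x₀)
            exact tdist_comm _ _
          rw [this]; exact hdesc
  -- inject the near plaquettes into `ball × directions × directions`
  have hinj : Set.InjOn (fun p : Plaq P i => (p.src, p.μ, p.ν))
      ↑((Finset.univ : Finset (Plaq P i)).filter
        (fun p => ∃ c ∈ plaqCover p, ∃ x ∈ plaqCover a, sdist (j - 1) c x ≤ ϱ)) := by
    intro p _ q _ hpq
    simp only [Prod.mk.injEq] at hpq
    obtain ⟨ps, pμ, pν, ph⟩ := p
    obtain ⟨qs, qμ, qν, qh⟩ := q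
    simp only at hpq
    obtain ⟨h1, h2, h3⟩ := hpq
    subst h1; subst h2; subst h3; rfl
  have hmaps : ∀ p ∈ (Finset.univ : Finset (Plaq P i)).filter
      (fun p => ∃ c ∈ plaqCover p, ∃ x ∈ plaqCover a, sdist (j - 1) c x ≤ ϱ),
      (fun p : Plaq P i => (p.src, p.μ, p.ν)) p ∈ ball ×ˢ ((Finset.univ : Finset (Fin P.d)) ×ˢ (Finset.univ : Finset (Fin P.d))) := by
    intro p hp
    rw [Finset.mem_product, Finset.mem_product]
    exact ⟨hsrc p hp, Finset.mem_univ _, Finset.mem_univ _⟩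
  calc ((Finset.univ : Finset (Plaq P i)).filter
          (fun p => ∃ c ∈ plaqCover p, ∃ x ∈ plaqCover a, sdist (j - 1) c x ≤ ϱ)).card
      ≤ (ball ×ˢ ((Finset.univ : Finset (Fin P.d)) ×ˢ (Finset.univ : Finset (Fin P.d)))).card :=
        Finset.card_le_card_of_injOn _ hmaps hinj
    _ = ball.card * (P.d * P.d) := by
        rw [Finset.card_product, Finset.card_product, Finset.card_univ, Fintype.card_fin]
    _ ≤ (2 * (R + 1)) ^ P.d * (P.d * P.d) := Nat.mul_le_mul_right _ (card_torusBall_le (coarsen i x₀) R)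
    _ = P.d * P.d * (2 * (P.L ^ (j - 1 - i) * (ϱ + P.L * (2 * P.d + 6) + P.d * (P.L - 1) + P.d) + 2 + 1)) ^ P.d := by
        rw [hR, Nat.mul_comm]

end Geometry

section CollarReal

variable {L : ℕ} {S : Scales L} (M₁ : ℕ) (Rcol : ℕ → ℕ)

/-- ★ **THE COLLAR COUNT, REAL FORM, FOR GIVEN `M₁` AND `Rcol`** — the lane's `Run3LargeField.collar_tower3` verbatim with the standard tower input's `D.M₁`, `D.Rcol` replaced by
parameters (its proof reads nothing else of `D`): for `M₁ ≥ 1`, collar widths antitone with `Rcol i ≤ ρ′·x(g_i)^{r₀}` on the window `i ≤ K`, `L ≥ 2`, `0 < g_i ≤ 1`: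
«|Z_j(h)| ≤ Σ_{(i,p′) ∈ P(h), i ≤ j} (K_c·x(g_i)^{r₀})³», `K_c = 2(2ρ′ + 2B + 20)`, `B = 3L(M₁ − 1) + 3(L − 1)` (`Run3Collar.zvol_le_sum`). [cite: Balaban1985UV3, (39) p.266, (41) p.266] -/
theorem zvol_real_le_sum (hM : 0 < M₁) (hRcol : ∀ i j, i ≤ j → j ≤ S.K → Rcol j ≤ Rcol i)
    (hL : 2 ≤ L) {ρ' r₀ : ℝ} (hρ : 0 ≤ ρ') (hr : 0 ≤ r₀)
    (hRle : ∀ i, i ≤ S.K → (Rcol i : ℝ) ≤ ρ' * xlog (S.gk i) ^ r₀)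
    (hg : ∀ i, i ≤ S.K → 0 < S.gk i ∧ S.gk i ≤ 1) :
    ∀ k, k ≤ S.K → ∀ (h : Hist S.P k) (j : ℕ), j < k →
      (ZVol M₁ Rcol k h j : ℝ) ≤
        ∑ e ∈ (Hist.disc h).filter (fun e => e.1 ≤ j),
          (2 * (2 * ρ' + 2 * ((L : ℝ) * (3 * ((M₁ : ℝ) - 1)) + 3 * ((L : ℝ) - 1)) + 20) * 1) ^ 3 *
            xlog (S.gk e.1) ^ (3 * r₀) := by
  intro k hk h j hjk
  classical
  have hjk' : j + 1 ≤ k := hjk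
  have hkP : k ≤ S.P.m + S.P.K := by show k ≤ S.m + S.K; omega
  have hLP : 2 ≤ S.P.L := hL
  have hM1 : 1 ≤ M₁ := hM
  have hL1 : 1 ≤ L := by omega
  have hMr : (1 : ℝ) ≤ M₁ := by exact_mod_cast hM1
  have hLr : (2 : ℝ) ≤ L := by exact_mod_cast hL
  have hN := zvol_le_sum M₁ Rcol hM hRcol hLP hkP hk h hjk'
  have hd : S.P.d = 3 := rfl
  have hPL : S.P.L = L := rfl
  rw [hd, hPL] at hN
  set Br : ℝ := (L : ℝ) * (3 * ((M₁ : ℝ) - 1)) + 3 * ((L : ℝ) - 1) with hBr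
  set Kc : ℝ := 2 * (2 * ρ' + 2 * Br + 20) * 1 with hKc
  have hBr0 : 0 ≤ Br := by rw [hBr]; nlinarith
  have hKc0 : 0 ≤ Kc := by rw [hKc]; nlinarith
  have hx1 : ∀ i, i ≤ S.K → 1 ≤ xlog (S.gk i) := fun i hi => one_le_xlog (hg i hi).1 (hg i hi).2
  have hxr : ∀ i, i ≤ S.K → 1 ≤ xlog (S.gk i) ^ r₀ := fun i hi => Real.one_le_rpow (hx1 i hi) hr
  have hxr3 : ∀ i, i ≤ S.K → xlog (S.gk i) ^ (3 * r₀) = (xlog (S.gk i) ^ r₀) ^ (3 : ℕ) := by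
    intro i hi
    have h3 : (3 : ℝ) * r₀ = r₀ * ((3 : ℕ) : ℝ) := by push_cast; ring
    rw [h3, Real.rpow_mul_natCast (by linarith [hx1 i hi])]
  have hFnn : ∀ i, i ≤ S.K → 0 ≤ Kc ^ 3 * xlog (S.gk i) ^ (3 * r₀) := fun i hi =>
    mul_nonneg (pow_nonneg hKc0 3) (Real.rpow_nonneg (by linarith [hx1 i hi]) _)
  have hterm : ∀ i : ℕ, i ≤ S.K →
      (((2 * ((2 * (Rcol i + (L * (3 * (M₁ - 1)) + 3 * (L - 1)) + 3) + 1 + (2 * 3 + 6)) + 1)) ^ 3 : ℕ) : ℝ) ≤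
        Kc ^ 3 * xlog (S.gk i) ^ (3 * r₀) := by
    intro i hi
    rw [Nat.cast_pow, hxr3 i hi, ← mul_pow]
    refine pow_le_pow_left₀ (Nat.cast_nonneg _) ?_ 3
    have hR := hRle i hi
    have hX := hxr i hi
    push_cast [Nat.cast_sub hM1, Nat.cast_sub hL1]
    rw [hKc, hBr]
    nlinarith [mul_nonneg hBr0 (sub_nonneg.mpr hX), mul_nonneg hρ (sub_nonneg.mpr hX)]
  let T : Finset (ℕ × PlaqCode S.P) := (Finset.univ : Finset (Fin (j + 1))).biUnion fun i =>
    (h (Fin.castLE hjk' i)).image fun p => ((i : ℕ), plaqCode p)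
  have hTsub : T ⊆ (Hist.disc h).filter (fun e => e.1 ≤ j) := by
    intro e he
    simp only [T, Finset.mem_biUnion, Finset.mem_univ, true_and, Finset.mem_image] at he
    obtain ⟨i, p, hp, rfl⟩ := he
    rw [Finset.mem_filter, Hist.mem_disc]
    exact ⟨⟨Fin.castLE hjk' i, p, hp, rfl⟩, by simpa using Nat.lt_succ_iff.mp i.2⟩
  have hTsum : ∑ e ∈ T, Kc ^ 3 * xlog (S.gk e.1) ^ (3 * r₀) =
      ∑ i : Fin (j + 1), ((h (Fin.castLE hjk' i)).card : ℝ) * (Kc ^ 3 * xlog (S.gk i) ^ (3 * r₀)) := by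
    rw [Finset.sum_biUnion]
    · refine Finset.sum_congr rfl fun i _ => ?_
      rw [Finset.sum_image]
      · simp only [Finset.sum_const, nsmul_eq_mul]
      · intro p _ q _ hpq
        exact plaqCode_injective _ (Prod.ext_iff.mp hpq).2
    · intro i _ i' _ hii'
      simp only [Function.onFun]
      rw [Finset.disjoint_left]
      intro e he he'
      rw [Finset.mem_image] at he he'
      obtain ⟨p, _, rfl⟩ := he
      obtain ⟨q, _, hq⟩ := he'
      exact hii' (Fin.ext (by have := (Prod.ext_iff.mp hq).1; exact_mod_cast this.symm))
  calc (ZVol M₁ Rcol k h j : ℝ)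
      ≤ ((∑ i : Fin (j + 1), (h (Fin.castLE hjk' i)).card *
          (2 * ((2 * (Rcol i + (L * (3 * (M₁ - 1)) + 3 * (L - 1)) + 3) + 1 + (2 * 3 + 6)) + 1)) ^ 3 : ℕ) : ℝ) := by
        exact_mod_cast hN
    _ = ∑ i : Fin (j + 1), ((h (Fin.castLE hjk' i)).card : ℝ) *
          (((2 * ((2 * (Rcol i + (L * (3 * (M₁ - 1)) + 3 * (L - 1)) + 3) + 1 + (2 * 3 + 6)) + 1)) ^ 3 : ℕ) : ℝ) := by
        rw [Nat.cast_sum]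
        refine Finset.sum_congr rfl fun i _ => ?_
        rw [Nat.cast_mul]
    _ ≤ ∑ i : Fin (j + 1), ((h (Fin.castLE hjk' i)).card : ℝ) * (Kc ^ 3 * xlog (S.gk i) ^ (3 * r₀)) :=
        Finset.sum_le_sum fun i _ => mul_le_mul_of_nonneg_left (hterm i (by omega)) (Nat.cast_nonneg _)
    _ = ∑ e ∈ T, Kc ^ 3 * xlog (S.gk e.1) ^ (3 * r₀) := hTsum.symm
    _ ≤ ∑ e ∈ (Hist.disc h).filter (fun e => e.1 ≤ j), Kc ^ 3 * xlog (S.gk e.1) ^ (3 * r₀) :=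
        Finset.sum_le_sum_of_subset_of_nonneg hTsub fun e he _ =>
          hFnn e.1 (by have := (Finset.mem_filter.mp he).2; omega)

end CollarReal

/-! ## §2 Arithmetic of the scale sum -/

section Arithmetic

/-- ★ `x^q·exp(−(κ∕2)·x^s) ≤ exp(−(κ∕2)·x²)` for `x ≥ 1`, `κ ≥ 2`, `0 ≤ q`, `q + 2 ≤ s` — the polynomial collar count is absorbed by the part of the small factor above the
quadratic (`u·e^{−v·u} ≤ e^{−v}` for `u, v ≥ 1`, `u = x^q`, `v = (κ∕2)x²`, since `u ≤ e^{u−1} ≤ e^{v(u−1)}`). [cite: Balaban1985UV3, (7) p.257, pp.273–274] -/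
theorem rpow_mul_exp_neg_le {x κ q s : ℝ} (hx : 1 ≤ x) (hκ : 2 ≤ κ) (hq : 0 ≤ q) (hqs : q + 2 ≤ s) :
    x ^ q * Real.exp (-(κ / 2 * x ^ s)) ≤ Real.exp (-(κ / 2 * x ^ 2)) := by
  have hx0 : 0 < x := by linarith
  set u : ℝ := x ^ q with hu
  set v : ℝ := κ / 2 * x ^ (2 : ℝ) with hv
  have hu1 : 1 ≤ u := Real.one_le_rpow hx hq
  have hx2 : (1 : ℝ) ≤ x ^ (2 : ℝ) := Real.one_le_rpow hx (by norm_num)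
  have hv1 : 1 ≤ v := by
    have : κ / 2 * 1 ≤ κ / 2 * x ^ (2 : ℝ) := mul_le_mul_of_nonneg_left hx2 (by linarith)
    linarith
  -- `x^s ≥ x^{q+2} = u·x²`
  have hs : u * x ^ (2 : ℝ) ≤ x ^ s := by
    rw [hu, ← Real.rpow_add hx0]
    exact Real.rpow_le_rpow_of_exponent_le hx hqs
  have h1 : Real.exp (-(κ / 2 * x ^ s)) ≤ Real.exp (-(v * u)) := by
    apply Real.exp_le_exp.mpr
    have : v * u = κ / 2 * (u * x ^ (2 : ℝ)) := by rw [hv]; ring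
    rw [this]
    have : κ / 2 * (u * x ^ (2 : ℝ)) ≤ κ / 2 * x ^ s := mul_le_mul_of_nonneg_left hs (by linarith)
    linarith
  -- `u·e^{−v u} ≤ e^{−v}`
  have h2 : u * Real.exp (-(v * u)) ≤ Real.exp (-v) := by
    have hu' : u ≤ Real.exp (v * (u - 1)) := by
      calc u ≤ (u - 1) + 1 := by ring_nf; exact le_rfl
        _ ≤ Real.exp (u - 1) := Real.add_one_le_exp _
        _ ≤ Real.exp (v * (u - 1)) := Real.exp_le_exp.mpr (by nlinarith)
    have : Real.exp (-v) = Real.exp (v * (u - 1)) * Real.exp (-(v * u)) := by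
      rw [← Real.exp_add]; ring_nf
    rw [this]
    exact mul_le_mul_of_nonneg_right hu' (Real.exp_pos _).le
  have hxq : (0 : ℝ) ≤ x ^ q := Real.rpow_nonneg hx0.le _
  calc x ^ q * Real.exp (-(κ / 2 * x ^ s)) ≤ u * Real.exp (-(v * u)) := mul_le_mul_of_nonneg_left h1 hxq
    _ ≤ Real.exp (-v) := h2
    _ = Real.exp (-(κ / 2 * x ^ 2)) := by rw [hv, Real.rpow_two]

/-- ★ `x ≥ 1 + t`, `t ≥ 0`, `κ ≥ 0` ⟹ `exp(−(κ∕2)x²) ≤ exp(−κ∕2)·exp(−κt)` (`x² ≥ 1 + 2t`). [folklore] -/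
theorem exp_neg_half_sq_le {x t κ : ℝ} (hx : 1 + t ≤ x) (ht : 0 ≤ t) (hκ : 0 ≤ κ) :
    Real.exp (-(κ / 2 * x ^ 2)) ≤ Real.exp (-(κ / 2)) * Real.exp (-(κ * t)) := by
  rw [← Real.exp_add]
  apply Real.exp_le_exp.mpr
  have h1 : 1 + 2 * t ≤ x ^ 2 := by nlinarith
  nlinarith

/-- ★★ **THE SCALE SUM OF THE COLLAR BRANCH** (pp. 273–274 read for the candidates near one pinned plaquette): with per-scale counts `N_i ≤ C·e^{σ(j−1−i)}·x_i^q` (`C ≥ 0`), the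
progression `x_i − x_j = (j − i)ℓ` and `x_j ≥ 1` on `i ≤ j`, and the provisos `κℓ ≥ σ + ℓ`, `κ ≥ 2`, `0 ≤ q`, `q + 2 ≤ s`, `0 ≤ σ`:
`Σ_{i<j} N_i·exp(−κ·x_i^s) ≤ (C∕ℓ)·exp(−(κ∕2)·x_j^s)` — half of the nearest scale's small factor survives, the other half pays the count and the scale entropy
(`rpow_mul_exp_neg_le`, `exp_neg_half_sq_le`, lit `geomTail_le`∕`expTail_le`). [cite: Balaban1985UV3, (5) p.256, (71) p.273, pp.273–274] -/
theorem scaleSum_collar_le {C σ ℓ κ q s : ℝ} {x : ℕ → ℝ} {j : ℕ} (N : ℕ → ℝ)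
    (hC : 0 ≤ C) (hσ : 0 ≤ σ) (hℓ : 0 < ℓ) (hκ : 2 ≤ κ) (hκℓ : σ + ℓ ≤ κ * ℓ) (hq : 0 ≤ q) (hqs : q + 2 ≤ s)
    (hxj : 1 ≤ x j) (hdiff : ∀ i, i ≤ j → x i - x j = ((j - i : ℕ) : ℝ) * ℓ)
    (hN : ∀ i, i < j → N i ≤ C * Real.exp (σ * ((j - 1 - i : ℕ) : ℝ)) * x i ^ q) :
    ∑ i ∈ Finset.range j, N i * Real.exp (-(κ * x i ^ s)) ≤ C / ℓ * Real.exp (-(κ / 2 * x j ^ s)) := by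
  have hκ0 : 0 ≤ κ := by linarith
  have hs0 : 0 ≤ s := by linarith
  -- per scale: count × small factor ≤ C·e^{−(κ/2)x_j^s}·e^{−ℓ(j−i)}
  have hterm : ∀ i ∈ Finset.range j, N i * Real.exp (-(κ * x i ^ s))
      ≤ C * Real.exp (-(κ / 2 * x j ^ s)) * Real.exp (-ℓ) ^ (j - i) := by
    intro i hi
    rw [Finset.mem_range] at hi
    have hxi : 1 + ((j - i : ℕ) : ℝ) * ℓ ≤ x i := by have := hdiff i hi.le; linarith
    have ht : (0 : ℝ) ≤ ((j - i : ℕ) : ℝ) * ℓ := mul_nonneg (Nat.cast_nonneg _) hℓ.le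
    have hxi1 : 1 ≤ x i := le_trans (by linarith) hxi
    have hxi0 : 0 < x i := by linarith
    have hxij : x j ≤ x i := by have := hdiff i hi.le; nlinarith
    -- split the small factor in two halves; the first half is monotone down the scales
    have hsplit : Real.exp (-(κ * x i ^ s)) = Real.exp (-(κ / 2 * x i ^ s)) * Real.exp (-(κ / 2 * x i ^ s)) := by
      rw [← Real.exp_add]; ring_nf
    have hmono : Real.exp (-(κ / 2 * x i ^ s)) ≤ Real.exp (-(κ / 2 * x j ^ s)) := by
      apply Real.exp_le_exp.mpr
      have : x j ^ s ≤ x i ^ s := Real.rpow_le_rpow (by linarith) hxij hs0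
      nlinarith
    -- the second half absorbs the polynomial count and pays the scale entropy
    have hpoly : x i ^ q * Real.exp (-(κ / 2 * x i ^ s)) ≤ Real.exp (-(κ / 2 * x i ^ 2)) := rpow_mul_exp_neg_le hxi1 hκ hq hqs
    have hsq : Real.exp (-(κ / 2 * x i ^ 2)) ≤ Real.exp (-(κ / 2)) * Real.exp (-(κ * (((j - i : ℕ) : ℝ) * ℓ))) :=
      exp_neg_half_sq_le hxi ht hκ0
    have hent : Real.exp (σ * ((j - 1 - i : ℕ) : ℝ)) * (Real.exp (-(κ / 2)) * Real.exp (-(κ * (((j - i : ℕ) : ℝ) * ℓ))))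
        ≤ Real.exp (-ℓ) ^ (j - i) := by
      rw [← Real.exp_nat_mul, ← Real.exp_add, ← Real.exp_add]
      apply Real.exp_le_exp.mpr
      have hn1 : ((j - 1 - i : ℕ) : ℝ) ≤ ((j - i : ℕ) : ℝ) := by exact_mod_cast (by omega : j - 1 - i ≤ j - i)
      have hn0 : (0 : ℝ) ≤ ((j - i : ℕ) : ℝ) := Nat.cast_nonneg _
      have h2 : 0 ≤ κ / 2 := by linarith
      nlinarith [mul_le_mul_of_nonneg_right hκℓ hn0, mul_le_mul_of_nonneg_left hn1 hσ]
    calc N i * Real.exp (-(κ * x i ^ s))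
        ≤ (C * Real.exp (σ * ((j - 1 - i : ℕ) : ℝ)) * x i ^ q) * Real.exp (-(κ * x i ^ s)) :=
          mul_le_mul_of_nonneg_right (hN i hi) (Real.exp_pos _).le
      _ = C * Real.exp (σ * ((j - 1 - i : ℕ) : ℝ)) * Real.exp (-(κ / 2 * x i ^ s)) * (x i ^ q * Real.exp (-(κ / 2 * x i ^ s))) := by
          rw [hsplit]; ring
      _ ≤ C * Real.exp (σ * ((j - 1 - i : ℕ) : ℝ)) * Real.exp (-(κ / 2 * x j ^ s)) * Real.exp (-(κ / 2 * x i ^ 2)) := by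
          have h0 : 0 ≤ C * Real.exp (σ * ((j - 1 - i : ℕ) : ℝ)) := mul_nonneg hC (Real.exp_pos _).le
          exact mul_le_mul (mul_le_mul_of_nonneg_left hmono h0) hpoly
            (mul_nonneg (Real.rpow_nonneg hxi0.le _) (Real.exp_pos _).le) (mul_nonneg h0 (Real.exp_pos _).le)
      _ ≤ C * Real.exp (σ * ((j - 1 - i : ℕ) : ℝ)) * Real.exp (-(κ / 2 * x j ^ s)) *
            (Real.exp (-(κ / 2)) * Real.exp (-(κ * (((j - i : ℕ) : ℝ) * ℓ)))) :=
          mul_le_mul_of_nonneg_left hsq (mul_nonneg (mul_nonneg hC (Real.exp_pos _).le) (Real.exp_pos _).le)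
      _ = C * Real.exp (-(κ / 2 * x j ^ s)) *
            (Real.exp (σ * ((j - 1 - i : ℕ) : ℝ)) * (Real.exp (-(κ / 2)) * Real.exp (-(κ * (((j - i : ℕ) : ℝ) * ℓ))))) := by ring
      _ ≤ C * Real.exp (-(κ / 2 * x j ^ s)) * Real.exp (-ℓ) ^ (j - i) :=
          mul_le_mul_of_nonneg_left hent (mul_nonneg hC (Real.exp_pos _).le)
  have hr0 : 0 ≤ Real.exp (-ℓ) := (Real.exp_pos _).le
  have hr1 : Real.exp (-ℓ) < 1 := Real.exp_lt_one_iff.mpr (by linarith)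
  calc ∑ i ∈ Finset.range j, N i * Real.exp (-(κ * x i ^ s))
      ≤ ∑ i ∈ Finset.range j, C * Real.exp (-(κ / 2 * x j ^ s)) * Real.exp (-ℓ) ^ (j - i) := Finset.sum_le_sum hterm
    _ = C * Real.exp (-(κ / 2 * x j ^ s)) * ∑ i ∈ Finset.range j, Real.exp (-ℓ) ^ (j - i) := by rw [Finset.mul_sum]
    _ ≤ C * Real.exp (-(κ / 2 * x j ^ s)) * (Real.exp (-ℓ) / (1 - Real.exp (-ℓ))) :=
        mul_le_mul_of_nonneg_left (geomTail_le hr0 hr1 j) (mul_nonneg hC (Real.exp_pos _).le)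
    _ ≤ C * Real.exp (-(κ / 2 * x j ^ s)) * (1 / ℓ) :=
        mul_le_mul_of_nonneg_left (expTail_le hℓ) (mul_nonneg hC (Real.exp_pos _).le)
    _ = C / ℓ * Real.exp (-(κ / 2 * x j ^ s)) := by ring

end Arithmetic

end Summit.QuantumFields.YangMills.Theorems.UV3PinnedCollarBranch
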